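import Summits.ValiantsHypothesis.ValiantsHypothesis.Theorems.LacunarySymmetroidMatrixDescartesGraftToolkit

/-!
# `MatrixDescartes` census — LIVE INDEFINITE ENDS: at an end whose letter has an isotropic vector seen by the next letter, the last
# flag window always carries an alternation (all sizes `m`, all supports)

HONEST FRAMING.  Cell `val-V1-extremal` (engine seat val-v1x-eng-6 g5), helper file `--supports` the crux `Theses.LacunarySymmetroid.MatrixDescartes`
(stmt-ValiantsHypothesis-18050), which is OPEN and asserted nowhere here.  STRUCTURE mathematics in census (CONJECTURE-A) currency about the cell's
END / FLAG mechanism, the companion of `…DeadDefiniteEnds` (a DEFINITE end letter kills every flag window beyond the last root).  Nothing here bears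
on the crux (an upper bound at fat formats), on `DoorA26` / `DoorA34`, or on `VP ≠ VNP`.  No definitions, no `sorry`.

THE LEMMA (`exists_rayleigh_alternation_top`).  Let `P(t) = ∑ₖ t^{dₖ} Sₖ` have top letter `S k₀` (strictly largest exponent) and second letter `S k₁`
(strictly larger exponent than every other letter except `k₀`; `k₁ ≠ k₀` is forced by the hypotheses), all letters symmetric.  Suppose `w` is ISOTROPIC for the top letter, `wᵀ S k₀ w = 0`,
but not for the second, `wᵀ S k₁ w ≠ 0`, and not in the kernel direction seen by some `v`: `wᵀ S k₀ v ≠ 0` (for a nonsingular indefinite `S k₀` such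
`w, v` exist generically).  Then for every threshold `T` there are a direction `u = w ± η v` and two scales `T ≤ x < y` with
`(uᵀ P(x) u) · (uᵀ P(y) u) < 0`: the `1 × 1` compression — the carrier of the LAST window of the tree's flag certificate
(`Census.Graft.exists_flag_certificate`, coordinate `u` switched on last) — ALTERNATES beyond `T`.  Mechanism: at a large fixed `x` the Rayleigh
quotient of `w` has the sign of the second coefficient `wᵀ S k₁ w` (the top coefficient vanishes), and so does that of `w ± η v` for small `η`
(continuity); its top coefficient `±2η·wᵀS k₀ v + η²·vᵀS k₀ v` has the sign of `±wᵀ S k₀ v`, and one of the two signs is opposite to `wᵀ S k₁ w`; far out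
the top coefficient decides.  So an end letter with such an isotropic vector is «live»: in census words its flag capacity has `γ_{m−1} ≥ 1`, a far letter
there can be made worth at least `m + 1` by the flag certificate (given the one-point non-vanishing of the earlier windows), against exactly `m` at a
definite end (`…DeadDefiniteEnds`).

LOCATED READING (seat report HOME/eng-6/g5/REPORT-g5.md, m = 3 END-YIELD TABLE, 469 census cores, 938 ends, exact): 94/94 definite ends have capacity
`(0,0)`; 816 of the 844 indefinite ends have capacity `≥ 1` (modal value the «perfect flag» `(2,1)`).  [folklore] dominant-term asymptotics of a
fewnomial and continuity; elementary.
-/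

-- `Summit.ValiantsHypothesis.ValiantsHypothesis.…` repeats a component by the D-0017 layout
-- (single-conjunct summit), which the `dupNamespace` linter flags; the name is mandated.
set_option linter.dupNamespace false

namespace Summit.ValiantsHypothesis.ValiantsHypothesis.Theorems.LacunarySymmetroidMatrixDescartes.Census.LiveEnd

open Matrix Finset Filter Topology
open scoped BigOperators
open Summit.ValiantsHypothesis.ValiantsHypothesis.Theorems.LacunarySymmetroidMatrixDescartes.Census.Graft
  (eventually_mul_pos_of_tendsto mul_neg_of_carriers)

variable {κ : Type} [Fintype κ]

/-! ### Dominant term of a fewnomial with real coefficients -/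

/-- `(∑ₖ t^{dₖ} cₖ) / t^{d k₁} → c k₁` as `t → ∞` when every other NONZERO coefficient sits at a strictly smaller exponent. [folklore] -/
theorem tendsto_sum_div_pow (d : κ → ℕ) (c : κ → ℝ) (k₁ : κ) (h : ∀ k, k ≠ k₁ → c k = 0 ∨ d k < d k₁) :
    Tendsto (fun t : ℝ => (∑ k, t ^ d k * c k) / t ^ d k₁) atTop (𝓝 (c k₁)) := by
  classical
  have hsum : ∀ t : ℝ, (∑ k, t ^ d k * c k) / t ^ d k₁ = ∑ k, t ^ d k * c k / t ^ d k₁ := fun t => by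
    rw [Finset.sum_div]
  simp_rw [hsum]
  have hlim : c k₁ = ∑ k, (if k = k₁ then c k₁ else 0) := by
    rw [Finset.sum_ite_eq' Finset.univ k₁]; simp
  rw [hlim]
  refine tendsto_finsetSum _ fun k _ => ?_
  by_cases hk : k = k₁
  · subst hk
    simp only [if_true]
    have hev : (fun t : ℝ => t ^ d k * c k / t ^ d k) =ᶠ[atTop] fun _ => c k := by
      filter_upwards [eventually_gt_atTop (0 : ℝ)] with t ht
      exact mul_div_cancel_left₀ (c k) (pow_ne_zero _ ht.ne')
    exact (tendsto_congr' hev).mpr tendsto_const_nhds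
  · simp only [if_neg hk]
    rcases h k hk with h0 | hlt
    · simp [h0]
    · -- `t^{d k} c / t^{d k₁} = c / t^{d k₁ - d k}` → 0
      have hpos : 0 < d k₁ - d k := Nat.sub_pos_of_lt hlt
      have hev : (fun t : ℝ => t ^ d k * c k / t ^ d k₁) =ᶠ[atTop] fun t => c k * (t ^ (d k₁ - d k))⁻¹ := by
        filter_upwards [eventually_gt_atTop (0 : ℝ)] with t ht
        have hsplit : t ^ d k₁ = t ^ d k * t ^ (d k₁ - d k) := by
          rw [← pow_add, Nat.add_sub_cancel' hlt.le]
        rw [hsplit, mul_div_mul_comm, div_self (pow_ne_zero _ ht.ne'), one_mul, div_eq_mul_inv]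
      refine (tendsto_congr' hev).mpr ?_
      have h1 : Tendsto (fun t : ℝ => (t ^ (d k₁ - d k))⁻¹) atTop (𝓝 0) :=
        (tendsto_pow_atTop hpos.ne').inv_tendsto_atTop
      simpa using h1.const_mul (c k)

/-- **Eventual sign of a fewnomial = sign of its dominant coefficient.** [folklore] -/
theorem eventually_pos_mul_dominant (d : κ → ℕ) (c : κ → ℝ) (k₁ : κ) (h : ∀ k, k ≠ k₁ → c k = 0 ∨ d k < d k₁)
    (hc : c k₁ ≠ 0) : ∀ᶠ t : ℝ in atTop, 0 < (∑ k, t ^ d k * c k) * c k₁ := by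
  have hev := eventually_mul_pos_of_tendsto (tendsto_sum_div_pow d c k₁ h) hc
  filter_upwards [hev, eventually_gt_atTop (0 : ℝ)] with t ht htpos
  have hpow : 0 < t ^ d k₁ := pow_pos htpos _
  have : (∑ k, t ^ d k * c k) * c k₁ = ((∑ k, t ^ d k * c k) / t ^ d k₁ * c k₁) * t ^ d k₁ := by
    field_simp
  rw [this]
  exact mul_pos ht hpow

/-! ### The Rayleigh quotient of the pencil along a fixed vector -/

/-- `uᵀ P(t) u = ∑ₖ t^{dₖ} · uᵀ Sₖ u`. [folklore] -/
theorem rayleigh_pencil {ι : Type} [Fintype ι] (d : κ → ℕ) (S : κ → Matrix ι ι ℝ) (u : ι → ℝ) (t : ℝ) :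
    u ⬝ᵥ ((∑ k, t ^ d k • S k) *ᵥ u) = ∑ k, t ^ d k * (u ⬝ᵥ (S k *ᵥ u)) := by
  rw [Matrix.sum_mulVec, dotProduct_sum]
  refine Finset.sum_congr rfl fun k _ => ?_
  rw [smul_mulVec, dotProduct_smul, smul_eq_mul]

/-- Expansion of the form along `w + η v` for a symmetric letter: `a + 2ηb + η²c`. [folklore] -/
theorem form_add_smul {ι : Type} [Fintype ι] (A : Matrix ι ι ℝ) (hA : A.IsSymm) (w v : ι → ℝ) (η : ℝ) :
    (w + η • v) ⬝ᵥ (A *ᵥ (w + η • v))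
      = w ⬝ᵥ (A *ᵥ w) + 2 * η * (w ⬝ᵥ (A *ᵥ v)) + η ^ 2 * (v ⬝ᵥ (A *ᵥ v)) := by
  have hsym : v ⬝ᵥ (A *ᵥ w) = w ⬝ᵥ (A *ᵥ v) := by
    rw [dotProduct_mulVec, ← Matrix.mulVec_transpose, hA.eq, dotProduct_comm]
  rw [mulVec_add, mulVec_smul, add_dotProduct, dotProduct_add, dotProduct_add, smul_dotProduct, smul_dotProduct,
    dotProduct_smul, dotProduct_smul, hsym]
  simp only [smul_eq_mul]
  ring

/-! ### The live-end lemma -/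

/-- **LIVE INDEFINITE END (top).**  See the module docstring: an isotropic vector of the top letter that is anisotropic for the second letter and
not `S k₀`-orthogonal to some `v` makes the `1 × 1` compression along `w + η v` or `w − η v` alternate beyond any threshold `T`. [folklore] -/
theorem exists_rayleigh_alternation_top {ι : Type} [Fintype ι] (d : κ → ℕ) (S : κ → Matrix ι ι ℝ) (hS : ∀ k, (S k).IsSymm)
    (k₀ k₁ : κ) (htop : ∀ k, k ≠ k₀ → d k < d k₀) (hsec : ∀ k, k ≠ k₀ → k ≠ k₁ → d k < d k₁)
    (w v : ι → ℝ) (hw0 : w ⬝ᵥ (S k₀ *ᵥ w) = 0) (hw1 : w ⬝ᵥ (S k₁ *ᵥ w) ≠ 0) (hwv : w ⬝ᵥ (S k₀ *ᵥ v) ≠ 0) (T : ℝ) :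
    ∃ (u : ι → ℝ) (x y : ℝ), T ≤ x ∧ x < y ∧
      (u ⬝ᵥ ((∑ k, x ^ d k • S k) *ᵥ u)) * (u ⬝ᵥ ((∑ k, y ^ d k • S k) *ᵥ u)) < 0 := by
  classical
  -- abbreviations for the three coefficient families
  set a : κ → ℝ := fun k => w ⬝ᵥ (S k *ᵥ w) with ha
  set b : κ → ℝ := fun k => w ⬝ᵥ (S k *ᵥ v) with hb
  set c : κ → ℝ := fun k => v ⬝ᵥ (S k *ᵥ v) with hc
  -- (1) a scale `x ≥ T` where the quotient of `w` has the sign of `a k₁`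
  have hdomw : ∀ k, k ≠ k₁ → a k = 0 ∨ d k < d k₁ := by
    intro k hk
    by_cases hk0 : k = k₀
    · left; rw [hk0]; exact hw0
    · right; exact hsec k hk0 hk
  obtain ⟨x, hxT, hxsign⟩ : ∃ x, T ≤ x ∧ 0 < (∑ k, x ^ d k * a k) * a k₁ := by
    have hev := (eventually_pos_mul_dominant d a k₁ hdomw hw1).and (eventually_ge_atTop T)
    obtain ⟨x, h1, h2⟩ := hev.exists
    exact ⟨x, h2, h1⟩
  -- (2) the quotient of `w + η v` at the fixed scale `x`, as a function of `η`, is continuous and equals that of `w` at `η = 0`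
  set qx : ℝ → ℝ := fun η => ∑ k, x ^ d k * (a k + 2 * η * b k + η ^ 2 * c k) with hqx
  have hqx_cont : Continuous qx := by
    refine continuous_finsetSum _ fun k _ => ?_
    exact continuous_const.mul ((continuous_const.add (continuous_const.mul continuous_id |>.mul continuous_const)).add
      ((continuous_id.pow 2).mul continuous_const))
  have hqx0 : qx 0 = ∑ k, x ^ d k * a k := by
    simp [hqx]
  have hqx_ev : ∀ᶠ η : ℝ in 𝓝 0, 0 < qx η * a k₁ := by
    have ht : Tendsto qx (𝓝 0) (𝓝 (qx 0)) := hqx_cont.tendsto 0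
    have hne : qx 0 * a k₁ ≠ 0 := by rw [hqx0]; exact hxsign.ne'
    have hopen : IsOpen {z : ℝ | 0 < z * a k₁} := isOpen_lt continuous_const (continuous_id.mul continuous_const)
    have hmem : qx 0 ∈ {z : ℝ | 0 < z * a k₁} := by simpa [hqx0] using hxsign
    exact ht.eventually (hopen.mem_nhds hmem)
  -- (3) the top coefficient along `w + η v` is `2η b k₀ + η² c k₀`; for small `η ≠ 0` it has the sign of `η · b k₀`
  have htop_ev : ∀ᶠ η : ℝ in 𝓝 0, η ≠ 0 → 0 < (2 * η * b k₀ + η ^ 2 * c k₀) * (η * b k₀) := by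
    -- `(2ηb + η²c)(ηb) = η²(2b² + ηcb)` and `2b² + ηcb → 2b² > 0`
    have ht : Tendsto (fun η : ℝ => 2 * b k₀ ^ 2 + η * (c k₀ * b k₀)) (𝓝 0) (𝓝 (2 * b k₀ ^ 2 + 0 * (c k₀ * b k₀))) :=
      tendsto_const_nhds.add (tendsto_id.mul tendsto_const_nhds)
    rw [zero_mul, add_zero] at ht
    have hpos : 0 < 2 * b k₀ ^ 2 := by positivity
    have hev := ht.eventually (isOpen_lt continuous_const continuous_id |>.mem_nhds hpos)
    filter_upwards [hev] with η hη hη0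
    have : (2 * η * b k₀ + η ^ 2 * c k₀) * (η * b k₀) = η ^ 2 * (2 * b k₀ ^ 2 + η * (c k₀ * b k₀)) := by ring
    rw [this]
    exact mul_pos (by positivity) hη
  -- pick one `η > 0` satisfying (2) for `±η` and (3) for `±η`
  have hboth : ∀ᶠ η : ℝ in 𝓝 0, (0 < qx η * a k₁ ∧ 0 < qx (-η) * a k₁) ∧
      (η ≠ 0 → 0 < (2 * η * b k₀ + η ^ 2 * c k₀) * (η * b k₀)) ∧
      (-η ≠ 0 → 0 < (2 * (-η) * b k₀ + (-η) ^ 2 * c k₀) * ((-η) * b k₀)) := by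
    have hneg : Tendsto (fun η : ℝ => -η) (𝓝 0) (𝓝 0) := by
      simpa using (continuous_neg.tendsto (0 : ℝ))
    exact (hqx_ev.and (hneg.eventually hqx_ev)).and (htop_ev.and (hneg.eventually htop_ev))
  obtain ⟨η, ⟨⟨hq_pos, hq_neg⟩, htop_pos, htop_neg⟩, hηpos⟩ :
      ∃ η, ((0 < qx η * a k₁ ∧ 0 < qx (-η) * a k₁) ∧
        (η ≠ 0 → 0 < (2 * η * b k₀ + η ^ 2 * c k₀) * (η * b k₀)) ∧
        (-η ≠ 0 → 0 < (2 * (-η) * b k₀ + (-η) ^ 2 * c k₀) * ((-η) * b k₀))) ∧ 0 < η := by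
    have h' : ∀ᶠ η : ℝ in 𝓝[>] 0, ((0 < qx η * a k₁ ∧ 0 < qx (-η) * a k₁) ∧
        (η ≠ 0 → 0 < (2 * η * b k₀ + η ^ 2 * c k₀) * (η * b k₀)) ∧
        (-η ≠ 0 → 0 < (2 * (-η) * b k₀ + (-η) ^ 2 * c k₀) * ((-η) * b k₀))) ∧ η ∈ Set.Ioi (0 : ℝ) :=
      (hboth.filter_mono nhdsWithin_le_nhds).and eventually_mem_nhdsWithin
    obtain ⟨η, hη, hmem⟩ := h'.exists
    exact ⟨η, hη, hmem⟩
  have hη0 : η ≠ 0 := hηpos.ne'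
  -- choose the sign `σ ∈ {1, −1}` so that the top coefficient of `w + σ η v` has the sign OPPOSITE to `a k₁`
  obtain ⟨σ, hσ, hq, hA⟩ : ∃ σ : ℝ, (σ = 1 ∨ σ = -1) ∧ 0 < qx (σ * η) * a k₁ ∧
      (2 * (σ * η) * b k₀ + (σ * η) ^ 2 * c k₀) * a k₁ < 0 := by
    have hp := htop_pos hη0
    have hn := htop_neg (neg_ne_zero.mpr hη0)
    have hbb : 0 < b k₀ * b k₀ := mul_self_pos.mpr hwv
    rcases lt_or_gt_of_ne (mul_ne_zero hw1 hwv : a k₁ * b k₀ ≠ 0) with hlt | hgt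
    · -- `a k₁ · b k₀ < 0`: take `σ = 1` (top coefficient has the sign of `b k₀ = −sign a k₁`)
      refine ⟨1, Or.inl rfl, by simpa using hq_pos, ?_⟩
      have hre : (2 * (1 * η) * b k₀ + (1 * η) ^ 2 * c k₀) = (2 * η * b k₀ + η ^ 2 * c k₀) := by ring
      rw [hre]
      set A := 2 * η * b k₀ + η ^ 2 * c k₀ with hAdef
      have hAb : 0 < A * b k₀ := by
        have h1 : 0 < η * (A * b k₀) := by
          have : A * (η * b k₀) = η * (A * b k₀) := by ring
          rw [← this]; exact hp
        exact pos_of_mul_pos_right h1 hηpos.le |> fun h => (pos_iff_pos_of_mul_pos h1).mp hηpos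
      have hprod : A * a k₁ * (b k₀ * b k₀) < 0 := by
        have := mul_neg_of_pos_of_neg hAb hlt
        have hre2 : A * a k₁ * (b k₀ * b k₀) = (A * b k₀) * (a k₁ * b k₀) := by ring
        rw [hre2]; exact this
      by_contra hcon
      exact absurd hprod (not_lt.mpr (mul_nonneg (not_lt.mp hcon) hbb.le))
    · refine ⟨-1, Or.inr rfl, by simpa using hq_neg, ?_⟩
      have hre : (2 * (-1 * η) * b k₀ + (-1 * η) ^ 2 * c k₀) = (2 * (-η) * b k₀ + (-η) ^ 2 * c k₀) := by ring
      rw [hre]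
      set A := 2 * (-η) * b k₀ + (-η) ^ 2 * c k₀ with hAdef
      have hAb : A * b k₀ < 0 := by
        have h1 : 0 < η * (-(A * b k₀)) := by
          have : A * ((-η) * b k₀) = η * (-(A * b k₀)) := by ring
          rw [← this]; exact hn
        have h2 : 0 < -(A * b k₀) := (pos_iff_pos_of_mul_pos h1).mp hηpos
        linarith
      have hprod : A * a k₁ * (b k₀ * b k₀) < 0 := by
        have := mul_neg_of_neg_of_pos hAb hgt
        have hre2 : A * a k₁ * (b k₀ * b k₀) = (A * b k₀) * (a k₁ * b k₀) := by ring
        rw [hre2]; exact this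
      by_contra hcon
      exact absurd hprod (not_lt.mpr (mul_nonneg (not_lt.mp hcon) hbb.le))
  -- the direction and its coefficient family
  set u : ι → ℝ := w + (σ * η) • v with hu
  set e : κ → ℝ := fun k => u ⬝ᵥ (S k *ᵥ u) with he
  have he_exp : ∀ k, e k = a k + 2 * (σ * η) * b k + (σ * η) ^ 2 * c k := fun k =>
    form_add_smul (S k) (hS k) w v (σ * η)
  have he_top : e k₀ = 2 * (σ * η) * b k₀ + (σ * η) ^ 2 * c k₀ := by
    rw [he_exp, show a k₀ = 0 from hw0, zero_add]
  have he_ne : e k₀ ≠ 0 := by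
    rw [he_top]; intro h0; rw [h0, zero_mul] at hA; exact lt_irrefl 0 hA
  -- value at `x`
  have hqx_u : u ⬝ᵥ ((∑ k, x ^ d k • S k) *ᵥ u) = qx (σ * η) := by
    rw [rayleigh_pencil]
    simp only [hqx]
    exact Finset.sum_congr rfl fun k _ => by rw [← he_exp k]
  -- (4) a scale `y > x` where the quotient of `u` has the sign of its top coefficient
  have hdomu : ∀ k, k ≠ k₀ → e k = 0 ∨ d k < d k₀ := fun k hk => Or.inr (htop k hk)
  obtain ⟨y, hyx, hysign⟩ : ∃ y, x < y ∧ 0 < (∑ k, y ^ d k * e k) * e k₀ := by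
    have hev := (eventually_pos_mul_dominant d e k₀ hdomu he_ne).and (eventually_gt_atTop x)
    obtain ⟨y, h1, h2⟩ := hev.exists
    exact ⟨y, h2, h1⟩
  refine ⟨u, x, y, hxT, hyx, ?_⟩
  rw [hqx_u, rayleigh_pencil]
  -- carriers: `qx(ση)` carries `a k₁`, the value at `y` carries `e k₀`, and `a k₁ · e k₀ < 0`
  have h3 : a k₁ * e k₀ < 0 := by rw [he_top, mul_comm]; exact hA
  exact mul_neg_of_carriers hq hysign h3

end Summit.ValiantsHypothesis.ValiantsHypothesis.Theorems.LacunarySymmetroidMatrixDescartes.Census.LiveEnd
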